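import Literature.AlgebraicGeometry.AbelianSchemes.LevelBasisFiniteEtaleCoverValues
import Literature.AlgebraicGeometry.AbelianSchemes.SymplecticLiftTransportRelevel
import Literature.AlgebraicGeometry.AbelianSchemes.SymplecticLiftChangeLevel
import Literature.AlgebraicGeometry.AbelianSchemes.FibrePointsMulEquivPoints
import Literature.AlgebraicGeometry.AbelianSchemes.PolarizedAbelianSchemeWithLevelBaseChange
import HarnessLib

/-!
# The pointwise step of the symplectic refinement cover: over every geometric point of the base, the cover of
# level-`NK` bases has a point REFINING the given level-`N` structure and CARRYING A SYMPLECTIC LIFT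

Layer `Literature/AlgebraicGeometry/AbelianSchemes`, namespace `Literature.AlgebraicGeometry.AbelianSchemes.AbelianSchemeOver`.
THEOREMS ONLY (no definition, no named fact, no instance, no `sorry`).  Cell `hodgecm-mathlib` (D-0151), F-DAG F-10 (b)
«classify for `M/Γ`», step (b4) «the cover», byte (5) (author B-p02 (g13); B-p06 (g11)'s census `F10b-CENSUS-SKELETON`
§road 1); count-neutral capital.  HC_CM is proved only modulo the 7 printed citations until rung 0 closes; nothing here is
about HC.

The step.  [MumfordFogartyKirwan1994] App. 7A / Ch. 7 §3 (p. 139): the forgetful morphisms `𝒜_{g,δ,nm} → 𝒜_{g,δ,n}` are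
finite and SURJECTIVE — over every geometric point, a symplectic-liftable level-`n` structure extends to a symplectic-liftable
level-`nm` structure ([Lan2013PELCompactifications] Def. 1.3.6.2: the two levels `n ∣ nm` of ONE tower
`α̂ : ẑ^{2g} ⥲ T̂ A_s̄`).  In the currency of the cover of level-`M` bases WITH VALUES (★ `LevelBasisFiniteEtaleCoverValues`:
`b : B → T` finite étale, `Φ` a level-`M` structure on `A ×_T B`, every basis `x` of `A_s̄[M]` is the value `Φ(t)` at a
point `t` over `s̄`), `M = N·K`: given a level-`N` structure `ψ` on `A/T`, a geometric point `s̄` of `T`, a witness `Θ` of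
the polarisation at `s̄` and a symplectic lift `Λ` of `ψ` at `s̄`, take `x :=` the LEVEL-`M` STAGE `Λ_M(eᵢ)` of the tower
(read in `FibrePoints` through ★ `exists_mulEquiv_fibrePoints_points`); the realising point `t` then satisfies

* (i) `Φ(t)` REFINES `ψ(s̄)`: `t ≫ (Φᵢ^K) = t ≫ (ψᵢ ×_T B)` for all `i` — tower compatibility `[K] ∘ Λ_M = Λ_N` and
  `Λ_N(eᵢ) = ψᵢ(s̄)` (★ `lift_compat`, `lift_level`, `lift_congr`), read back through ★ `fibrePointsBaseChangeEquiv` /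
  ★ `restrict_sectionBaseChange`; this is the test-morphism form consumed by ★ `exists_isClopen_comp_left_eq_iff`;
* (ii) `Φ` HAS A SYMPLECTIC LIFT AT `t` for the ample witness `e^*Θ` of `λ ×_T B` (`e : (A ×_T B)_t ≅ A_{t ≫ b}`,
  ★ `fibreBaseChangeIso`, ★ `IsLambdaOfAt.baseChange`): the tower `Λ` transported along `e` and re-levelled onto `Φ(t)`
  (★ `SymplecticLift.nonempty_transport_relevel`) — the one-lift input of the liftable-locus criterion.

* `SymplecticLift.coe_lift_single_pow` — `Λ_M(eᵢ)^K = ψᵢ(s̄)` for `M = N·K`;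
* `FibrePoints.eq_of_left_comp_fst_eq` — an `Ω`-point of `(A ×_T B)_t` is determined by its image in `A`;
* **`LevelStructure.exists_point_refining_nonempty_symplecticLift`** — the step, for ANY cover with the value clause.

## References
* [MumfordFogartyKirwan1994] D. Mumford, J. Fogarty, F. Kirwan, *Geometric Invariant Theory*, 3rd ed. (1994), Ch. 7 §2
  Definition 7.1 (p. 129), Ch. 7 §3 (p. 139), App. 7A (p. 235).
* [Lan2013PELCompactifications] K.-W. Lan, *Arithmetic compactifications of PEL-type Shimura varieties* (2013), §1.3.6
  Def. 1.3.6.2 (p. 80), Lemma 1.3.6.5 (p. 81).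
* [GortzWedhorn2020] U. Görtz, T. Wedhorn, *Algebraic Geometry I*, 2nd ed. (2020), Section (4.7), (4.7.1) (p. 108).
-/

noncomputable section

universe u

open CategoryTheory CategoryTheory.Limits AlgebraicGeometry

namespace Literature.AlgebraicGeometry.AbelianSchemes

namespace AbelianSchemeOver

open Literature.AlgebraicGeometry.Motives
open scoped MonObj

/-! ### §1 Two small dictionaries -/

section Tower

variable {S : Scheme.{u}} {A : AbelianSchemeOver S} {g N : ℕ} {φ : A.LevelStructure g N} {Ω : Type u} [Field Ω]
  {s : Spec (.of Ω) ⟶ S} {Θ : CartierDivisor (A.fibre s).toAbelianVariety.X.left} {δ : Fin g → ℕ}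

/-- **`Λ_M(eᵢ)^K = φᵢ(s̄)` for `M = N·K`**: the level-`M` stage of a symplectic lift of the level-`N` structure `φ` powers
down to `φ(s̄)` (tower compatibility ★ `lift_compat` at `k = K`, the index identity `M = K·N` through ★ `lift_congr`, and
★ `lift_level`; the computation inside ★ `LevelStructureRefinement` §4, at an arbitrary geometric point).
[cite: Lan2013PELCompactifications, §1.3.6 Def. 1.3.6.2 (p. 80) and Lemma 1.3.6.5 (p. 81)] -/
theorem LevelStructure.SymplecticLift.coe_lift_single_pow (Λ : φ.SymplecticLift s Θ δ) {K M : ℕ} (hM : M = N * K)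
    (hN₀ : N ≠ 0) (hK₀ : K ≠ 0) (i : Fin g ⊕ Fin g) :
    ((Λ.lift M (Multiplicative.ofAdd (Pi.single i 1)) : (A.fibre s).toAbelianVariety.torsionPoints Ω (M : ℤ)) :
        (A.fibre s).toAbelianVariety.Points Ω) ^ K = A.restrictPt s (φ.σ i) := by
  -- adapted from ★ `LevelStructureRefinement` (`exists_levelStructure_lift_eq`, the `changeLevel` step)
  have hKN : M = K * N := hM.trans (Nat.mul_comm _ _)
  rw [Λ.lift_congr hKN]
  have hfun : (fun j => (ZMod.cast ((Pi.single i (1 : ZMod M) : Fin g ⊕ Fin g → ZMod M) j) : ZMod (K * N))) =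
      Pi.single i (1 : ZMod (K * N)) := by
    funext j
    by_cases hji : j = i
    · subst hji; rw [Pi.single_eq_same, Pi.single_eq_same, ZMod.cast_one (dvd_of_eq hKN.symm)]
    · rw [Pi.single_eq_of_ne hji, Pi.single_eq_of_ne hji, ZMod.cast_zero]
  rw [hfun]
  have hc := Λ.lift_compat K (Pi.single i (1 : ZMod (K * N))) dvd_rfl hN₀ hK₀
  have hcast : (fun j => ZMod.castHom (Dvd.intro_left K rfl) (ZMod N) ((Pi.single i (1 : ZMod (K * N)) :
      Fin g ⊕ Fin g → ZMod (K * N)) j)) = Pi.single i (1 : ZMod N) := by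
    funext j
    by_cases hji : j = i
    · subst hji; rw [Pi.single_eq_same, Pi.single_eq_same, map_one]
    · rw [Pi.single_eq_of_ne hji, Pi.single_eq_of_ne hji, map_zero]
  rw [hcast] at hc
  rw [← hc, Λ.lift_level i]

end Tower

section Point

variable {T B : Scheme.{u}} (A : AbelianSchemeOver T) (b : B ⟶ T) {Ω : Type u} [Field Ω] (t : Spec (.of Ω) ⟶ B)

/-- **An `Ω`-point of `(A ×_T B)_t` (in `FibrePoints` currency) is determined by its image in `A`**: its underlying
morphism `Spec Ω → A ×_T B` has second component `t`. [cite: GortzWedhorn2020, Section (4.7), (4.7.1) (p. 108)] -/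
theorem FibrePoints.eq_of_left_comp_fst_eq {z z' : (A.baseChange b).FibrePoints t}
    (h : z.left ≫ pullback.fst A.X.hom b = z'.left ≫ pullback.fst A.X.hom b) : z = z' := by
  have hz : z.left ≫ pullback.snd A.X.hom b = t := Over.w z
  have hz' : z'.left ≫ pullback.snd A.X.hom b = t := Over.w z'
  exact Over.OverMorphism.ext (pullback.hom_ext h (hz.trans hz'.symm))

end Point

/-! ### §2 The pointwise step -/

section Step

variable {T B : Scheme.{u}} {A : AbelianSchemeOver T} [IsCommMonObj A.X] (b : B ⟶ T) {g N K M : ℕ}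

/-- **THE POINTWISE STEP OF THE SYMPLECTIC REFINEMENT COVER.**  Let `b : B → T` carry a level-`M` structure `Φ` on
`A ×_T B` with the VALUE CLAUSE of ★ `exists_finite_etale_levelStructure_restrict_eq` (every basis of `A_s̄[M]` is `Φ(t)`
for a point `t` over `s̄`), `M = N·K ≠ 0`, `ψ` a level-`N` structure on `A/T`, `s̄ = s₀` a geometric point of `T`, `Θ` an
ample witness of the polarisation `λ` at `s₀` and `Λ` a symplectic lift of `ψ` at `s₀` for `Θ`.  Then there is a point `t`
of `B` over `s₀` such that (i) `Φ(t)` refines `ψ`: `t ≫ (Φ.changeLevel N K)ᵢ = t ≫ (ψ ×_T B)ᵢ` for all `i` (the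
test-morphism form of ★ `exists_isClopen_comp_left_eq_iff`), and (ii) `Φ` has a symplectic lift at `t` for an ample
witness `Θ′` of `λ ×_T B` at `t` (namely `e^*Θ`, `e : (A ×_T B)_t ≅ A_{t ≫ b}`).  Construction: `x :=` the level-`M` stage
`Λ_M(eᵢ)` of the tower read in `FibrePoints` (★ `exists_mulEquiv_fibrePoints_points`) — `M`-torsion and independent
because `Λ_M` is a bijection `(ℤ/M)^{2g} ⥲ A_{s₀}[M]`; realise it by `t` (value clause); (i) is `Λ_M(eᵢ)^K = ψᵢ(s₀)`
(`coe_lift_single_pow`) read through ★ `fibrePointsBaseChangeEquiv`/`restrict_sectionBaseChange`; (ii) is ★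
`SymplecticLift.nonempty_transport_relevel` along `e` (★ `fibreBaseChangeIso`), the witness moved by ★
`IsLambdaOfAt.baseChange`.  This is the geometric-point surjectivity of [MumfordFogartyKirwan1994] App. 7A's finite
morphisms `𝒜_{g,δ,nm} → 𝒜_{g,δ,n}` in the cover's currency. [cite: MumfordFogartyKirwan1994, Ch. 7 §3 (p. 139) and App. 7A (p. 235)]
[cite: Lan2013PELCompactifications, §1.3.6 Def. 1.3.6.2 (p. 80) and Lemma 1.3.6.5 (p. 81)] -/
theorem LevelStructure.exists_point_refining_nonempty_symplecticLift (hM : M = N * K) (hM₀ : M ≠ 0)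
    (Φ : (A.baseChange b).LevelStructure g M)
    (hreal : ∀ ⦃Ω : Type u⦄ [Field Ω] (s : Spec (.of Ω) ⟶ T) (x : Fin g ⊕ Fin g → A.FibrePoints s),
        (∀ i, x i ^ M = 1) →
        Function.Injective (fun a : Fin g ⊕ Fin g → ZMod M =>
          (List.ofFn fun i : Fin g => x (Sum.inl i) ^ (a (Sum.inl i)).val).prod *
            (List.ofFn fun i : Fin g => x (Sum.inr i) ^ (a (Sum.inr i)).val).prod) →
        ∃ t : Spec (.of Ω) ⟶ B, t ≫ b = s ∧
          ∀ i, ((A.baseChange b).restrict t (Φ.σ i)).left ≫ pullback.fst A.X.hom b = (x i).left)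
    {D : A.DualPair} (pol : A.Polarization D) (δ : Fin g → ℕ) (ψ : A.LevelStructure g N)
    {Ω : Type u} [Field Ω] (s₀ : Spec (.of Ω) ⟶ T)
    {Θ : CartierDivisor (A.fibre s₀).toAbelianVariety.X.left} (hΘ : Θ.IsAmple) (hlam : A.IsLambdaOfAt s₀ D pol.lam Θ)
    (Λ : ψ.SymplecticLift s₀ Θ δ) :
    ∃ t : Spec (.of Ω) ⟶ B, t ≫ b = s₀ ∧
      (∀ i, t ≫ ((Φ.changeLevel N K hM hM₀).σ i).left = t ≫ ((ψ.baseChange b).σ i).left) ∧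
      ∃ Θ' : CartierDivisor ((A.baseChange b).fibre t).toAbelianVariety.X.left,
        Θ'.IsAmple ∧ (A.baseChange b).IsLambdaOfAt t (D.baseChange b) (pol.baseChange b).lam Θ' ∧
          Nonempty (Φ.SymplecticLift t Θ' δ) := by
  classical
  have hNM : N ∣ M := ⟨K, hM⟩
  haveI : NeZero M := ⟨hM₀⟩
  have hN₀ : N ≠ 0 := fun h => hM₀ (by rw [hM, h, Nat.zero_mul])
  have hK₀ : K ≠ 0 := fun h => hM₀ (by rw [hM, h, Nat.mul_zero])
  -- the partner equivalence at `s₀` and the level-`M` stage of the tower in `FibrePoints` currency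
  obtain ⟨eΩ, heΩ⟩ := A.exists_mulEquiv_fibrePoints_points s₀
  obtain ⟨L, hLdef⟩ : ∃ L : Multiplicative (Fin g ⊕ Fin g → ZMod M) →* A.FibrePoints s₀,
      ∀ v, L v = eΩ.symm ((Λ.lift M v : (A.fibre s₀).toAbelianVariety.torsionPoints Ω (M : ℤ)) :
        (A.fibre s₀).toAbelianVariety.Points Ω) :=
    ⟨eΩ.symm.toMonoidHom.comp (((A.fibre s₀).toAbelianVariety.torsionPoints Ω (M : ℤ)).subtype.comp (Λ.lift M)),
      fun v => rfl⟩
  have hL : ∀ v, (L v).left = A.fibrePointToLeft s₀ ((Λ.lift M v :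
      (A.fibre s₀).toAbelianVariety.torsionPoints Ω (M : ℤ)) : (A.fibre s₀).toAbelianVariety.Points Ω) := fun v => by
    rw [← heΩ (L v), hLdef, MulEquiv.apply_symm_apply]
  have hLinj : Function.Injective L := fun v w h => by
    rw [hLdef, hLdef] at h
    exact (Λ.lift_bijective hNM hM₀).1 (Subtype.ext (eΩ.symm.injective h))
  obtain ⟨x, hx⟩ : ∃ x : Fin g ⊕ Fin g → A.FibrePoints s₀, ∀ i, x i = L (Multiplicative.ofAdd (Pi.single i 1)) :=
    ⟨_, fun _ => rfl⟩
  have hxM : ∀ i, x i ^ M = 1 := fun i => by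
    have hsm : M • (Pi.single i (1 : ZMod M) : Fin g ⊕ Fin g → ZMod M) = 0 := by
      funext k
      rw [Pi.smul_apply, Pi.zero_apply, nsmul_eq_mul, ZMod.natCast_self, zero_mul]
    rw [hx, ← map_pow, ← ofAdd_nsmul, hsm, ofAdd_zero, map_one]
  have hxprod : ∀ a : Fin g ⊕ Fin g → ZMod M,
      (List.ofFn fun i : Fin g => x (Sum.inl i) ^ (a (Sum.inl i)).val).prod *
        (List.ofFn fun i : Fin g => x (Sum.inr i) ^ (a (Sum.inr i)).val).prod = L (Multiplicative.ofAdd a) := by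
    intro a
    rw [LevelBasis.listProd_pow_mul_listProd_pow_eq_prod x a]
    simp only [hx]
    exact LevelBasis.prod_map_ofAdd_single_pow_val L a
  have hxinj : Function.Injective (fun a : Fin g ⊕ Fin g → ZMod M =>
      (List.ofFn fun i : Fin g => x (Sum.inl i) ^ (a (Sum.inl i)).val).prod *
        (List.ofFn fun i : Fin g => x (Sum.inr i) ^ (a (Sum.inr i)).val).prod) := by
    intro a a' h
    dsimp only at h
    rw [hxprod, hxprod] at h
    exact Multiplicative.ofAdd.injective (hLinj h)
  -- realise `x` by a point `t` of `B` over `s₀`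
  obtain ⟨t, ht, hval⟩ := hreal s₀ x hxM hxinj
  subst ht
  -- `Φᵢ(t) = e_t (xᵢ)` in `FibrePoints` currency
  have hres : ∀ i, (A.baseChange b).restrict t (Φ.σ i) = A.fibrePointsBaseChangeEquiv b t (x i) := fun i =>
    FibrePoints.eq_of_left_comp_fst_eq A b t (by rw [hval i, A.left_fibrePointsBaseChangeEquiv_comp_fst])
  refine ⟨t, rfl, fun i => ?_, ?_⟩
  · -- (i) `Φ(t)` refines `ψ(t ≫ b)`
    change ((A.baseChange b).restrict t ((Φ.changeLevel N K hM hM₀).σ i)).left =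
      ((A.baseChange b).restrict t ((ψ.baseChange b).σ i)).left
    suffices h : (A.baseChange b).restrict t ((Φ.changeLevel N K hM hM₀).σ i) =
        (A.baseChange b).restrict t ((ψ.baseChange b).σ i) by rw [h]
    have hpow : (A.baseChange b).restrict t (Φ.σ i ^ K) = ((A.baseChange b).restrict t (Φ.σ i)) ^ K :=
      MonObj.comp_pow _ _ _
    rw [LevelStructure.changeLevel_σ, LevelStructure.baseChange_σ, A.restrict_sectionBaseChange b t, hpow, hres i,
      ← map_pow]
    congr 1
    -- `(x i)^K = ψᵢ|(t ≫ b)`: both are partners of `ψᵢ(t ≫ b)`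
    refine A.fibrePoints_eq_of_fibrePointToLeft_eq (t ≫ b) (P := A.restrictPt (t ≫ b) (ψ.σ i)) ?_
      (A.fibrePointToLeft_restrictPt (t ≫ b) (ψ.σ i))
    rw [hx, ← map_pow, hL, map_pow, Subgroup.coe_pow, Λ.coe_lift_single_pow hM hN₀ hK₀ i]
  · -- (ii) the symplectic lift of `Φ` at `t` for `e^*Θ`
    haveI := A.isIso_toSchemeHom_fibreBaseChangeIso b t
    have he : ∀ i : Fin g ⊕ Fin g,
        AlgPoints.map (A.fibreBaseChangeIso b t).hom.hom.hom.hom ((A.baseChange b).restrictPt t (Φ.σ i)) =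
          ((Λ.lift M (Multiplicative.ofAdd (Pi.single i 1)) :
              (A.fibre (t ≫ b)).toAbelianVariety.torsionPoints Ω (M : ℤ)) :
            (A.fibre (t ≫ b)).toAbelianVariety.Points Ω) := by
      intro i
      refine A.points_eq_of_fibrePointToLeft_eq (t ≫ b) (x := x i) ?_ ?_
      · -- the transported point lies over `t ≫ Φᵢ ≫ pr_A = xᵢ`
        have h1 : ((A.baseChange b).restrictPt t (Φ.σ i)).left ≫ pullback.fst (pullback.snd A.X.hom b) t =
            t ≫ (Φ.σ i).left := (A.baseChange b).restrictPt_left_fst t (Φ.σ i)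
        change (AlgPoints.map (A.fibreBaseChangeIso b t).hom.hom.hom.hom
            ((A.baseChange b).restrictPt t (Φ.σ i))).left ≫ pullback.fst A.X.hom (t ≫ b) = _
        rw [A.map_fibreBaseChangeIso_left b t, Category.assoc, A.fibreBaseChangeIso_hom_toSchemeHom_fst b t]
        have h2 : ((A.baseChange b).restrictPt t (Φ.σ i)).left ≫ pullback.fst (pullback.snd A.X.hom b) t ≫
            pullback.fst A.X.hom b = (t ≫ (Φ.σ i).left) ≫ pullback.fst A.X.hom b := by
          rw [← h1]
          exact (Category.assoc _ _ _).symm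
        exact h2.trans (hval i)
      · rw [hx, hL]
    obtain ⟨Λ'⟩ := Λ.nonempty_transport_relevel (ψ := Φ) (A.fibreBaseChangeIso b t) hNM he
    exact ⟨A.divisorBaseChange b t Θ, hΘ.pullback _, IsLambdaOfAt.baseChange A b D t pol.lam Θ hlam, ⟨Λ'⟩⟩

end Step

end AbelianSchemeOver

end Literature.AlgebraicGeometry.AbelianSchemes

end
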